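import Summits.CriticalPhenomena.PercolationContinuityZ3.Theorems.PercNearOneGluingNoHeavyPcintBSMXSiteKernel
import HarnessLib

/-!
# PCINT lane, PHASE 8 (block renewal, SITE version), step 5: symmetries of the site functional and orbit reduction

Cell `prim-pcint`, seat `prim-pcint-1` (gen 16); memo `run/shared/lean/prim/pcint/T-FIBRE-ROUTE.md` §PHASE 8.

The SITE analogue of …PcintBSMSym / …PcintBSMXSym2 for the transverse plane `t = 2`: the shared-vertex count is
antipodally symmetric (`BSMX.SV_neg`) and invariant under coordinate permutations and sign flips of a closed piece
family (`BSMX.tverts_perm`, `BSMX.tverts_flip`, `BSMX.SV_perm`, `BSMX.SV_flip`), hence so is the site certificate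
functional (`BSMX.certLHSV_neg/perm/flip`) and the integer certificate inequalities reduce to orbit representatives
of `[-4,4]^2` under the dihedral group (**`BSMX.certZV_of_reps2`**).
-/

noncomputable section

namespace Summit.CriticalPhenomena.PercolationContinuityZ3.Theorems.Pcint.BSMX

open Finset OSM BSM

variable {t k np : ℕ}

/-! ### The antipodal symmetry -/

/-- Shifting by `-y` then by `y` is the identity. -/
theorem shiftV_neg_trans (y : Fin t → ℤ) :
    (shiftV (k := k) (-y)).trans (shiftV y) = Function.Embedding.refl _ := by
  ext q <;> simp [shiftV, Function.Embedding.trans]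

/-- **`SV (-y) σ σ' = SV y σ' σ`.** -/
theorem SV_neg (pc : Fin np → List (Fin t × Bool)) (k : ℕ) (y : Fin t → ℤ) (σ σ' : Fin np) :
    SV pc k (-y) σ σ' = SV pc k y σ' σ := by
  unfold SV
  rw [← Finset.card_map (shiftV y), Finset.map_inter, Finset.map_map, shiftV_neg_trans, Finset.map_refl,
    Finset.inter_comm]

/-- **The site functional is even in `y`** (for even tables). -/
theorem certLHSV_neg (pc : Fin np → List (Fin t × Bool)) (w : Fin np → ℝ) (k : ℕ) (x : ℝ)
    {V0f V1f : (Fin t → ℤ) → ℝ} (hV0 : ∀ u, V0f (-u) = V0f u) (hV1 : ∀ u, V1f (-u) = V1f u) (y : Fin t → ℤ) :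
    certLHSV pc w k x V0f V1f (-y) = certLHSV pc w k x V0f V1f y := by
  unfold certLHSV
  rw [Finset.sum_comm]
  refine sum_congr rfl fun σ _ => sum_congr rfl fun σ' _ => ?_
  rw [SV_neg, mul_comm (w σ') (w σ)]
  have hu : -y + (pend (pc σ) - pend (pc σ')) = -(y + (pend (pc σ') - pend (pc σ))) := by abel
  rw [hu, hV0, hV1]

/-! ### Coordinate permutations -/

/-- The action on vertex keys. -/
def pVK (p : Equiv.Perm (Fin t)) (k : ℕ) : VKey t k ↪ VKey t k :=
  ⟨fun q => (q.1, pv p q.2), fun q q' h => by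
    simp only [Prod.mk.injEq] at h
    exact Prod.ext h.1 (pv_injective p h.2)⟩

/-- **Equivariance of the entered vertices under coordinate permutations.** -/
theorem tverts_perm (p : Equiv.Perm (Fin t)) (k : ℕ) : ∀ (u : Fin t → ℤ) (σ : List (Fin t × Bool)),
    tverts k (pv p u) (σ.map (pq p)) = (tverts k u σ).map (pVK p k)
  | u, [] => by simp [tverts]
  | u, q :: σ => by
    rw [List.map_cons, tverts, tverts, Finset.map_insert, ← pv_sv, ← pv_add, tverts_perm p k (u + sv q) σ]
    rfl

/-- Shifts are equivariant. -/
theorem shiftV_trans_pVK (p : Equiv.Perm (Fin t)) (k : ℕ) (y : Fin t → ℤ) :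
    (shiftV (k := k) y).trans (pVK p k) = (pVK p k).trans (shiftV (pv p y)) := by
  ext q <;> simp [shiftV, pVK, pv_add, Function.Embedding.trans]

/-- **`SV` is invariant under coordinate permutations** of the offset and of the pieces. -/
theorem SV_perm (pc : Fin np → List (Fin t × Bool)) (k : ℕ) (p : Equiv.Perm (Fin t)) (π : Fin np → Fin np)
    (hπ : ∀ σ, pc (π σ) = (pc σ).map (pq p)) (y : Fin t → ℤ) (σ σ' : Fin np) :
    SV pc k (pv p y) (π σ) (π σ') = SV pc k y σ σ' := by
  unfold SV
  have h1 := tverts_perm p k 0 (pc σ)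
  have h2 := tverts_perm p k 0 (pc σ')
  rw [pv_zero] at h1 h2
  have e : ∀ s : Finset (VKey t k), insert ((0 : Fin k → ℤ), (0 : Fin t → ℤ)) (s.map (pVK p k)) =
      (insert ((0 : Fin k → ℤ), (0 : Fin t → ℤ)) s).map (pVK p k) := fun s => by
    rw [Finset.map_insert]; congr 1
  rw [hπ, hπ, h1, h2, e, e, Finset.map_map, ← shiftV_trans_pVK, ← Finset.map_map, ← Finset.map_inter, Finset.card_map]

/-- **The site functional is invariant under coordinate permutations** (closed piece family, invariant weights
and tables). -/
theorem certLHSV_perm (pc : Fin np → List (Fin t × Bool)) (w : Fin np → ℝ) (k : ℕ) (x : ℝ)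
    {V0f V1f : (Fin t → ℤ) → ℝ} (p : Equiv.Perm (Fin t)) (π : Fin np ≃ Fin np)
    (hπ : ∀ σ, pc (π σ) = (pc σ).map (pq p)) (hw : ∀ σ, w (π σ) = w σ)
    (hV0 : ∀ u, V0f (pv p u) = V0f u) (hV1 : ∀ u, V1f (pv p u) = V1f u) (y : Fin t → ℤ) :
    certLHSV pc w k x V0f V1f (pv p y) = certLHSV pc w k x V0f V1f y := by
  unfold certLHSV
  rw [← π.sum_comp]
  refine sum_congr rfl fun σ _ => ?_
  rw [← π.sum_comp]
  refine sum_congr rfl fun σ' _ => ?_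
  rw [SV_perm pc k p π hπ, hw, hw, hπ, hπ, pend_perm, pend_perm]
  have hu : pv p y + (pv p (pend (pc σ')) - pv p (pend (pc σ))) = pv p (y + (pend (pc σ') - pend (pc σ))) := by
    rw [pv_add, pv_sub]
  rw [hu, hV0, hV1]

/-! ### Coordinate sign flips -/

/-- The action on vertex keys. -/
def fVK (c : Fin t) (k : ℕ) : VKey t k ↪ VKey t k :=
  ⟨fun q => (q.1, negC c q.2), fun q q' h => by
    simp only [Prod.mk.injEq] at h
    exact Prod.ext h.1 (negC_injective c h.2)⟩

/-- **Equivariance of the entered vertices under a sign flip.** -/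
theorem tverts_flip (c : Fin t) (k : ℕ) : ∀ (u : Fin t → ℤ) (σ : List (Fin t × Bool)),
    tverts k (negC c u) (σ.map (flipAx c)) = (tverts k u σ).map (fVK c k)
  | u, [] => by simp [tverts]
  | u, q :: σ => by
    rw [List.map_cons, tverts, tverts, Finset.map_insert, ← negC_sv, ← negC_add, tverts_flip c k (u + sv q) σ]
    rfl

/-- Shifts are equivariant. -/
theorem shiftV_trans_fVK (c : Fin t) (k : ℕ) (y : Fin t → ℤ) :
    (shiftV (k := k) y).trans (fVK c k) = (fVK c k).trans (shiftV (negC c y)) := by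
  ext q <;> simp [shiftV, fVK, negC_add, Function.Embedding.trans]

/-- **`SV` is invariant under a sign flip** of the offset and of the pieces. -/
theorem SV_flip (pc : Fin np → List (Fin t × Bool)) (k : ℕ) (c : Fin t) (π : Fin np → Fin np)
    (hπ : ∀ σ, pc (π σ) = (pc σ).map (flipAx c)) (y : Fin t → ℤ) (σ σ' : Fin np) :
    SV pc k (negC c y) (π σ) (π σ') = SV pc k y σ σ' := by
  unfold SV
  have h1 := tverts_flip c k 0 (pc σ)
  have h2 := tverts_flip c k 0 (pc σ')
  rw [negC_zero] at h1 h2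
  have e : ∀ s : Finset (VKey t k), insert ((0 : Fin k → ℤ), (0 : Fin t → ℤ)) (s.map (fVK c k)) =
      (insert ((0 : Fin k → ℤ), (0 : Fin t → ℤ)) s).map (fVK c k) := fun s => by
    rw [Finset.map_insert]; congr 1; all_goals exact Prod.ext rfl (negC_zero c).symm
  rw [hπ, hπ, h1, h2, e, e, Finset.map_map, ← shiftV_trans_fVK, ← Finset.map_map, ← Finset.map_inter, Finset.card_map]

/-- **The site functional is invariant under a sign flip** (closed piece family, invariant weights and tables). -/
theorem certLHSV_flip (pc : Fin np → List (Fin t × Bool)) (w : Fin np → ℝ) (k : ℕ) (x : ℝ)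
    {V0f V1f : (Fin t → ℤ) → ℝ} (c : Fin t) (π : Fin np ≃ Fin np)
    (hπ : ∀ σ, pc (π σ) = (pc σ).map (flipAx c)) (hw : ∀ σ, w (π σ) = w σ)
    (hV0 : ∀ u, V0f (negC c u) = V0f u) (hV1 : ∀ u, V1f (negC c u) = V1f u) (y : Fin t → ℤ) :
    certLHSV pc w k x V0f V1f (negC c y) = certLHSV pc w k x V0f V1f y := by
  unfold certLHSV
  rw [← π.sum_comp]
  refine sum_congr rfl fun σ _ => ?_
  rw [← π.sum_comp]
  refine sum_congr rfl fun σ' _ => ?_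
  rw [SV_flip pc k c π hπ, hw, hw, hπ, hπ, pend_flip, pend_flip]
  have hu : negC c y + (negC c (pend (pc σ')) - negC c (pend (pc σ))) = negC c (y + (pend (pc σ') - pend (pc σ))) := by
    rw [negC_add, negC_sub]
  rw [hu, hV0, hV1]

/-! ### Orbit reduction of the integer site certificate (`t = 2`) -/

/-- **Orbit reduction of the integer site certificate** (`[-4,4]^2` → representatives). -/
theorem certZV_of_reps2 (pc : Fin np → List (Fin 2 × Bool)) {pe : Fin np → (Fin 2 → ℤ)}
    (hpe : ∀ σ, pe σ = pend (pc σ)) (W : Fin np → ℕ) {k : ℕ} (hk : 1 ≤ k) {B E : ℕ} (hB : 0 < B)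
    (hE : ∀ σ, (pc σ).length + 1 ≤ E) (π₁ π₂ : Fin np ≃ Fin np)
    (hπ₁ : ∀ σ, pc (π₁ σ) = (pc σ).map (pq (Equiv.swap 0 1)))
    (hπ₂ : ∀ σ, pc (π₂ σ) = (pc σ).map (flipAx 0))
    (hW₁ : ∀ σ, W (π₁ σ) = W σ) (hW₂ : ∀ σ, W (π₂ σ) = W σ)
    (V0n V1n Φn : (Fin 2 → ℤ) → ℕ) (hV0 : ∀ g u, V0n (gen2 g u) = V0n u) (hV1 : ∀ g u, V1n (gen2 g u) = V1n u)
    (hΦ : ∀ g u, Φn (gen2 g u) = Φn u) (DΦ M : ℤ) (R : List (Fin 2 → ℤ)) (G : List (List (Fin 3)))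
    (hclos : ∀ y ∈ boxList 2 4, ∃ w ∈ G, applyW2 w y ∈ R)
    (hR : ∀ y ∈ R, certLHSVz pe (SV2 pc k) W k 10000 B E V0n V1n y * DΦ ≤ (Φn y : ℤ) * M) :
    ∀ y ∈ boxList 2 4, certLHSVz pe (SV2 pc k) W k 10000 B E V0n V1n y * DΦ ≤ (Φn y : ℤ) * M := by
  have hV0a : ∀ u, V0n (-u) = V0n u := fun u => by rw [← (gen2_apply u).1]; exact hV0 0 u
  have hV0b : ∀ u, V0n (pv (Equiv.swap 0 1) u) = V0n u := fun u => by rw [← (gen2_apply u).2.1]; exact hV0 1 u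
  have hV1a : ∀ u, V1n (-u) = V1n u := fun u => by rw [← (gen2_apply u).1]; exact hV1 0 u
  have hV1b : ∀ u, V1n (pv (Equiv.swap 0 1) u) = V1n u := fun u => by rw [← (gen2_apply u).2.1]; exact hV1 1 u
  have hV0d : ∀ u, V0n (negC 0 u) = V0n u := fun u => by rw [← (gen2_apply u).2.2]; exact hV0 2 u
  have hV1d : ∀ u, V1n (negC 0 u) = V1n u := fun u => by rw [← (gen2_apply u).2.2]; exact hV1 2 u
  have hS2 : SV2 pc k = SV pc k := funext fun y => funext fun σ => funext fun σ' => (SV_eq_SV2 pc k y σ σ').symm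
  rw [hS2] at hR ⊢
  set f : (Fin 2 → ℤ) → ℤ := fun y => certLHSVz pe (SV pc k) W k 10000 B E V0n V1n y with hf
  have hcast : ∀ z, ((f z : ℤ) : ℝ) = certLHSV pc (fun σ => (W σ : ℝ) / (1 : ℕ)) k ((10000 : ℕ) / (B : ℝ))
      (fun u => (V0n u : ℝ) / (1 : ℕ)) (fun u => (V1n u : ℝ) / (1 : ℕ)) z *
        ((k : ℝ) * (B : ℝ) ^ E * ((1 : ℕ) : ℝ) ^ 2 * (1 : ℕ)) := fun z =>
    certLHSVz_cast pc hpe W hk 10000 hB hE V0n V1n z Nat.one_pos Nat.one_pos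
  have h0 : ∀ z, f (-z) = f z := fun z => by
    apply Int.cast_injective (α := ℝ)
    rw [hcast, hcast, certLHSV_neg pc _ k _ (fun u => by simp only [hV0a]) (fun u => by simp only [hV1a])]
  have h1 : ∀ z, f (pv (Equiv.swap 0 1) z) = f z := fun z => by
    apply Int.cast_injective (α := ℝ)
    rw [hcast, hcast, certLHSV_perm pc _ k _ (Equiv.swap 0 1) π₁ hπ₁ (fun σ => by simp only [hW₁])
      (fun u => by simp only [hV0b]) (fun u => by simp only [hV1b])]
  have h3 : ∀ z, f (negC 0 z) = f z := fun z => by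
    apply Int.cast_injective (α := ℝ)
    rw [hcast, hcast, certLHSV_flip pc _ k _ 0 π₂ hπ₂ (fun σ => by simp only [hW₂])
      (fun u => by simp only [hV0d]) (fun u => by simp only [hV1d])]
  have hgen : ∀ g z, f (gen2 g z) = f z := fun g z => by
    rcases gen2_apply z with ⟨e0, e1, e2⟩
    fin_cases g
    · exact (congr_arg f e0).trans (h0 z)
    · exact (congr_arg f e1).trans (h1 z)
    · exact (congr_arg f e2).trans (h3 z)
  intro y hy
  obtain ⟨w, _, hwR⟩ := hclos y hy
  have hfy : f (applyW2 w y) = f y := applyW2_invariant' f hgen w y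
  have hΦy : Φn (applyW2 w y) = Φn y := applyW2_invariant' Φn hΦ w y
  have := hR _ hwR
  rw [← hΦy]
  rw [hf] at hfy
  simp only at hfy
  rw [← hfy]
  exact this

end Summit.CriticalPhenomena.PercolationContinuityZ3.Theorems.Pcint.BSMX

end
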